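import Literature.Probability.LatticeModels.LatticeWalkWinding
import HarnessLib

/-!
# A face about which a closed lattice polygon winds lies in the domain
(line `symplectic-fermion-anchor`, crux `SAWLoopFugacityFlow.AvoidanceLimit`, stmt-CriticalPhenomena-10649)

The brick "S3b" of the shield lemma: if the polygon `walkPath p` of a closed nearest-neighbour
walk `p` of `ℤ²` lies in an open simply connected set `D' ⊆ ℂ` and the combinatorial winding
number `walkWinding p u` of `p` about the face centre `u + (½, ½)` is non-zero, then the whole
closed unit square `[u₀, u₀ + 1] × [u₁, u₁ + 1]` lies in `D'`.

Proof: a point `z` of the square on the polygon is in `D'` by hypothesis. Otherwise the segment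
from the face centre `ℓ = u + (½, ½)` to `z` misses the polygon (its points other than `z` lie in
the OPEN square, hence have no integer coordinate, while the polygon lies on the grid lines), so the
polygon winds equally about `ℓ` and about `z`
(`wind_sub_eq_of_mem_connectedComponentIn`); the former winding number is `walkWinding p u ≠ 0`
(`wind_walkPath_sub_faceCentre`), whereas a closed polygon in an open simply connected set does
not wind about points outside it (`wind_walkPath_sub_eq_zero_of_isSimplyConnected`), so
`z ∈ D'`. [folklore]
-/

noncomputable section

open scoped BigOperators Classical
open Set Complex SimpleGraph
open Literature.Topology.PlaneTopology
open Literature.Probability.Percolation (walkWinding)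
open Literature.Probability.LatticeModels

namespace Summit.CriticalPhenomena.SAWScalingLimit.Theorems.AvoidanceLimit.Anchor

/-- **A face about which a closed lattice polygon in an open simply connected set winds lies, as
a closed unit square, inside that set.** If `walkPath p ⊆ D'` for a closed walk `p` of `ℤ²`, `D'`
open and simply connected, and `walkWinding p u ≠ 0`, then
`[u₀, u₀ + 1] × [u₁, u₁ + 1] ⊆ D'`: the polygon winds equally about the face centre and about any
point of the closed face off the polygon (the joining segment misses the polygon, which lies on
the grid lines), and it does not wind about points outside `D'`. [folklore] -/
theorem face_subset_of_walkWinding_ne_zero :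
    ∀ (D' : Set ℂ), IsOpen D' → IsSimplyConnected D' → ∀ {a : Site 2} (p : (zdGraph 2).Walk a a),
      range (walkPath p) ⊆ D' → ∀ u : Site 2, walkWinding p u ≠ 0 →
        (Icc (u 0 : ℝ) (u 0 + 1) ×ℂ Icc (u 1 : ℝ) (u 1 + 1)) ⊆ D' := by
  intro D' hD' hsc a p hp u hw z hz
  rw [mem_reProdIm, mem_Icc, mem_Icc] at hz
  obtain ⟨⟨hz0l, hz0r⟩, hz1l, hz1r⟩ := hz
  by_contra hzD
  -- `z` is off the polygon, since the polygon lies in `D'`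
  have hzr : z ∉ range (walkPath p) := fun h => hzD (hp h)
  set ℓ : ℂ := ⟨(u 0 : ℝ) + 1 / 2, (u 1 : ℝ) + 1 / 2⟩ with hℓ
  have hℓre : ℓ.re = (u 0 : ℝ) + 1 / 2 := rfl
  have hℓim : ℓ.im = (u 1 : ℝ) + 1 / 2 := rfl
  -- the winding number about the face centre is `walkWinding p u ≠ 0`
  have hwind : wind (fun t => (walkPath p).extend t - ℓ) = walkWinding p u :=
    wind_walkPath_sub_faceCentre p u
  -- the winding number about `z ∉ D'` vanishes
  have hz0 : wind (fun t => (walkPath p).extend t - z) = 0 :=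
    wind_walkPath_sub_eq_zero_of_isSimplyConnected hD' hsc p hp hzD
  -- the segment `[ℓ, z]` misses the polygon
  have hseg : segment ℝ ℓ z ⊆ (range (walkPath p))ᶜ := by
    intro w hw' hwr
    obtain ⟨x, -, y, -, hxy, hws⟩ := exists_mem_segment_of_mem_range_walkPath p hwr
    obtain ⟨t, ht0, ht1, hre, him⟩ := exists_of_mem_segment hw'
    rw [hℓre] at hre
    rw [hℓim] at him
    rcases eq_or_lt_of_le ht1 with rfl | ht1'
    · -- `t = 1`: the point is `z` itself
      have hwz : w = z := Complex.ext (by rw [hre]; ring) (by rw [him]; ring)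
      exact hzr (hwz ▸ hwr)
    · -- `t < 1`: the point lies in the open square, off the grid lines
      rcases re_eq_or_im_eq_of_mem_segment hxy hws with h | h
      · have hc1 : 0 ≤ t * (z.re - u 0) := mul_nonneg ht0 (by linarith)
        have hc2 : 0 ≤ t * (u 0 + 1 - z.re) := mul_nonneg ht0 (by linarith)
        have h1 : (u 0 : ℝ) < x 0 := by rw [← h, hre]; nlinarith
        have h2 : (x 0 : ℝ) < u 0 + 1 := by rw [← h, hre]; nlinarith
        have h1' : u 0 < x 0 := by exact_mod_cast h1
        have h2' : x 0 < u 0 + 1 := by exact_mod_cast h2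
        omega
      · have hc1 : 0 ≤ t * (z.im - u 1) := mul_nonneg ht0 (by linarith)
        have hc2 : 0 ≤ t * (u 1 + 1 - z.im) := mul_nonneg ht0 (by linarith)
        have h1 : (u 1 : ℝ) < x 1 := by rw [← h, him]; nlinarith
        have h2 : (x 1 : ℝ) < u 1 + 1 := by rw [← h, him]; nlinarith
        have h1' : u 1 < x 1 := by exact_mod_cast h1
        have h2' : x 1 < u 1 + 1 := by exact_mod_cast h2
        omega
  -- hence `z` lies in the component of the face centre in the complement of the polygon
  have hK : IsClosed (range (walkPath p)) := (isCompact_range (walkPath p).continuous).isClosed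
  have hzc : z ∈ connectedComponentIn (range (walkPath p))ᶜ ℓ :=
    (convex_segment ℓ z).isPreconnected.subset_connectedComponentIn (left_mem_segment ℝ ℓ z) hseg
      (right_mem_segment ℝ ℓ z)
  have heq := wind_sub_eq_of_mem_connectedComponentIn (walkPath p).continuous_extend.continuousOn
    (by rw [Path.extend_zero, Path.extend_one]) hK
    (fun t ht => by rw [Path.extend_apply _ ht]; exact mem_range_self _) hzc
  rw [hwind, hz0] at heq
  exact hw heq

end Summit.CriticalPhenomena.SAWScalingLimit.Theorems.AvoidanceLimit.Anchor

end
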